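import Summits.Ventures.CertifiedManyBodySolver.Certificates.HubbardSquare_Hg1201_pinU_7o2_5_dext183q_WND
import Summits.Ventures.CertifiedManyBodySolver.Certificates.HubbardSquare_Hg1201_pinU_5_44o5_dext183q_WND
import Summits.Ventures.CertifiedManyBodySolver.Certificates.HubbardSquare_Hg1201_gsDoccCeilings
import Summits.Ventures.CertifiedManyBodySolver.Certificates.HubbardSquare_polCaps_hg1201_n179o200
import Summits.Ventures.CertifiedManyBodySolver.Theorems.CovHg1201M19bBundleWNClosers
import HarnessLib
import HarnessLib.Audit

/-!
# Ventures/CertifiedManyBodySolver — Theorems/CovHg1201M19bPatchLeftEdge.lean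

HONEST FRAMING: the CLOSING INSTANCE of crux «PatchLeftEdge» (stmt-Ventures-26186) of route `CovHg1201M19b` (HgBa₂CuO₄₊δ «Hg-1201» box `boxHg1201E_M19b`,
D-0154 (1)(C) COVERAGE) MODULO TWO CLAIM NODES — «26186 CLOSED MODULO NODES (derived edition; confirmation reads pending)» in the captain's words
(hubbard-cov-hg1201-plan-1 g3 ORDER 2026-08-28T14:20:39Z / CALL 14:38:58Z). ONE theorem, ONE term: the route decl `Theses.CovHg1201M19b.PatchLeftEdge` BY NAME from
* `h₁ : cert_hg1201_pinU_7o2_5_dext183q_wnd` — the DOCC-BOX bundle-WN node of the pinned U-family on `[7/2, 5] × {t′ = −27/50}` (edition `--ext 183:0:1/4`, F0 = −0.5060029028, derived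
  from the certificate bytes, three lineages ALL EQUAL), its docc slot DISCHARGED BY NAME by hubbard-cov-hg1201-box-2's `hg1201_gsDocc_le_quarter_leftCell_lowU` (p635674), its window by
  `covHg1201_leftThickCell_kinFloorFn` / `covHg1201_leftThickCell_qfPlaneCap` (node-free);
* `h₂ : cert_hg1201_pinU_5_44o5_dext183q_wnd` — the same on `[5, 44/5]` (F0 = −0.5040232546), docc slot by `hg1201_gsDocc_le_quarter_leftCell_highU` (cap −43/100), window by
  `covHg1201_leftThickCell_constCap_of_polCaps` (kernel polarised rows, node-free);
glued by `covHg1201M19b_PatchLeftEdge_of_twoCells (b := 5)` (`Theorems/CovHg1201M19bBundleWNClosers.lean`, p626127). Strip words: 0.5060030 on `[7/2, 5]`, 0.5060835 on `[5, 44/5]`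
(the `179/200` end of the spoke′ slope binds there) vs bar 0.5166800.
WHAT THIS IS NOT: a proof of the nodes (they are `@[conjecture] def`s — hypotheses BY NAME; the H21 audit records `proof.conditional`); a number of record; a statement about
HgBa₂CuO₄₊δ, `T_c`, pairing or any phase; a suppression claim (CONTROL / CALIBRATION wording class (xx1): «content» = below 0.98 × the kinematic MAJORANT; a ceiling never
speaks to the presence of superconductivity). stmt-Ventures-26186 stays OPEN on the ledger until its nodes are discharged or accepted as evidence by the gate's rules.
Seat `hubbard-cov-hg1201-box-1` (`prover-hubbard-cov-hg1201-box-1-g0-0`), @0 box lane, K1 lead.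

References: S. Boyd, L. Vandenberghe, *Convex Optimization* (2004) §5.9 [BoydVandenberghe2004]; D. J. Scalapino, S. R. White, S.-C. Zhang, PRB 47 (1993) 7995, §II
[ScalapinoWhiteZhang1993]; J. Wang et al., PRX 14 (2024) 031006, §III [WangEtAl2024].
-/

noncomputable section

namespace Summit.Ventures.CertifiedManyBodySolver.Theorems

open Summit.Ventures.CertifiedManyBodySolver.Certificates Summit.Ventures.CertifiedManyBodySolver
open Literature.MathematicalPhysics.QuantumLattice Literature.MathematicalPhysics.QuantumLattice.ThermodynamicLimit Literature.Probability.LatticeModels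
open Summit.Ventures.CertifiedManyBodySolver.Observables Set Filter Topology

/-- **«PatchLeftEdge» (stmt-Ventures-26186) from the two DOCC-BOX U-cell nodes of the derived edition `--ext 183:0:1/4`** — cells `[7/2, 5]` (`h₁`) and `[5, 44/5]` (`h₂`),
docc slots discharged by `hg1201_gsDocc_le_quarter_leftCell_lowU/_highU`, windows node-free, glue `covHg1201M19b_PatchLeftEdge_of_twoCells (b := 5)`. Conditional BY NAME on the
two claim nodes and on nothing else. [cite: ScalapinoWhiteZhang1993, §II] [cite: BoydVandenberghe2004, §5.9] [cite: WangEtAl2024, §III] -/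
theorem covHg1201M19b_PatchLeftEdge_of_dext183q_nodes (h₁ : cert_hg1201_pinU_7o2_5_dext183q_wnd) (h₂ : cert_hg1201_pinU_5_44o5_dext183q_wnd) :
    Summit.Ventures.CertifiedManyBodySolver.Theses.CovHg1201M19b.PatchLeftEdge :=
  covHg1201M19b_PatchLeftEdge_of_twoCells (b := 5)
    (covHg1201M19b_leftEdgeSegment_of_boxRowW (U₁ := 7/2) (U₂ := 5) (n₁ := 179 / 200) (n₂ := 183 / 200) (by norm_num) le_rfl (7/2)
      (cert_hg1201_pinU_7o2_5_dext183q_wnd_thickBoxRowW_of h₁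
        (fun U hU s hs x hx ω Ls ψ hLs hψ h1 hω _ => by
          obtain rfl : s = -27/50 := le_antisymm hs.2 hs.1
          exact (hg1201_gsDocc_le_quarter_leftCell_lowU ⟨le_trans (by norm_num) hU.1, hU.2.trans (by norm_num)⟩ hx ω Ls ψ hLs hψ h1 hω).trans (by norm_num)))
      (covHg1201_leftThickCell_kinFloorFn (U₁ := 7/2) (U₂ := 5) (by norm_num) (by norm_num) (by norm_num))
      (covHg1201_leftThickCell_qfPlaneCap (U₁ := 7/2) (U₂ := 5) (by norm_num)) (by push_cast; norm_num))
    (covHg1201M19b_leftEdgeSegment_of_boxRowW (U₁ := 5) (U₂ := 44/5) (n₁ := 179 / 200) (n₂ := 183 / 200) (by norm_num) le_rfl (7/2)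
      (cert_hg1201_pinU_5_44o5_dext183q_wnd_thickBoxRowW_of h₂
        (fun U hU s hs x hx ω Ls ψ hLs hψ h1 hω hcap => by
          obtain rfl : s = -27/50 := le_antisymm hs.2 hs.1
          exact (hg1201_gsDocc_le_quarter_leftCell_highU ⟨le_trans (by norm_num) hU.1, hU.2.trans (by norm_num)⟩ hx hcap (by push_cast; norm_num) ω Ls ψ hLs hψ h1 hω).trans
            (by norm_num)))
      (covHg1201_leftThickCell_kinFloorFn (U₁ := 5) (U₂ := 44/5) (by norm_num) (by norm_num) (by norm_num))
      (covHg1201_leftThickCell_constCap_of_polCaps (U₁ := 5) (U₂ := 44/5) (by norm_num) (c := -43/100) (by norm_num) (by norm_num)) (by push_cast; norm_num))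

end Summit.Ventures.CertifiedManyBodySolver.Theorems

end
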